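import Mathlib.Analysis.SpecialFunctions.Pow.Continuity
import Mathlib.Analysis.SpecialFunctions.Pow.Asymptotics
import Mathlib.Analysis.SpecificLimits.Basic
import Mathlib.LinearAlgebra.Matrix.ProjectiveSpecialLinearGroup
import Literature.Barriers.MatrixMultiplication.QuasirandomBarrierGLn
import Literature.Barriers.MatrixMultiplication.NilpotentGroupBarrierMatchings
import HarnessLib

/-!
# Barrier vocabulary (sequel to `QuasirandomBarrier.lean`): "meeting the packing bound" for a
# SEQUENCE of groups (BCGPU 2023, Def. 2.3) and the printed asymptotic forms of Cor. 3.3, of the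
# §2 remark linking it to Thm. 2.2, and of the fixed-rank claims of §3 — all PROVED

Topic `Literature/Barriers/MatrixMultiplication` (D-0021 catalogue for the summit `MatrixMultiplication`,
`ω(ℂ) = 2`); attached to the catalogue entry `QuasirandomBarrier` (Thm. 3.2 = `BCGPU2023_thm32`,
PROVED: `BCGPU2023_thm32_holds`).  Source: J. Blasiak, H. Cohn, J. A. Grochow, K. Pratt, C. Umans,
*Matrix multiplication via matrix groups*, ITCS 2023 = arXiv:2204.03826
[BlasiakCohnGrochowPrattUmans2023]; held copy `paper:arxiv-2204.03826` read with `lit read` this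
session (chunk = page of the held text):

* p. 5, **Definition 2.3**: "We say a sequence `G₁, G₂, …` of finite groups *meets the packing bound*
  if there exist subsets `Sᵢ`, `Tᵢ`, and `Uᵢ` of `Gᵢ` satisfying the triple product property such that
  `|Sᵢ| |Tᵢ| |Uᵢ| = |Gᵢ|^{3/2−o(1)}` as `i → ∞`."  Followed by: "A simple argument [Cohn–Umans 2003]
  shows that this can happen only if `|Gᵢ| → ∞`." and "Meeting the packing bound is a necessary
  condition for Thm. 2.2 to yield `ω = 2`: if a family of groups contains no sequence meeting the
  packing bound, then there is a constant `ε > 0` such that no group in the family can prove an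
  upper bound on `ω` better than `2 + ε` via Thm. 2.2."
* p. 6, **Corollary 3.3**: "No sequence `G₁, G₂, …` of finite groups satisfying
  `n(Gᵢ) ≥ Ω(|Gᵢ|^δ)` with `δ > 0` can meet the packing bound."
* p. 6, proof of Cor. 3.4, first paragraph: "groups of Lie type of bounded rank … satisfy
  `n(G) ≥ Ω(|G|^δ)` for some constant `δ > 0` … and this condition suffices by Cor. 3.3";
  p. 7, §3.2: "triples of subgroups in `GL(n,q)` with fixed `n` cannot meet the packing bound"
  and footnote "More generally, arbitrary subsets cannot meet the packing bound".
* H. Cohn, C. Umans, *A group-theoretic approach to fast matrix multiplication*, FOCS 2003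
  [CohnUmans2003], Lemma 3.1 (held copy `paper:arxiv-math_0307321`, p. 5: "The pseudo-exponent of a
  finite group `G` is always greater than `2` … the map `(x,y) ↦ x⁻¹y` is injective on `S₁ × S₂` and
  its image intersects the quotient set `Q(S₃)` only in the identity. Thus, `|G| ≥ n₁n₂`, and
  `|G| > n₁n₂` unless `n₃ = 1`. … Thus, `|G|³ > (n₁n₂n₃)²`") — the "simple argument" of Def. 2.3.

Until now the tree carried only the EFFECTIVE, single-group forms of these statements
(`BCGPU2023_thm32.cor33`: `|S||T||U| ≤ |G|^{3/2−δ/2}/√c + |G|`; `tpp_card_le_GL_rpow`,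
`SubgroupTPP.card_mul_le_GL`; the `noCertificate_…` theorems "Thm. 2.2's inequality HOLDS at
`w = 2 + ε`"), and the consumer index of the littype-FM1-1 seat listed Def. 2.3 as "(prose)".  This
file types Def. 2.3 itself and derives the printed sequence statements from the effective theorems.

## Contents (0 `sorry`, 0 new facts)

* §1 `MeetsPackingBound G` — Def. 2.3 for a sequence `G : ℕ → Type` of finite groups.
* §2 Cohn–Umans 2003 Lemma 3.1, strict part, PROVED: `card_mul_card_lt_of_tpp`
  (`|S||T| < |G|` once `|U| ≥ 2`), `card_prod_sq_lt_of_tpp` (`(|S||T||U|)² < |G|³` in a non-trivial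
  group), `tpp_card_lt_card_rpow` (`|S||T||U| < |G|^{3/2}`): the packing bound is never attained.
* §3 `MeetsPackingBound.tendsto_card_atTop` — "this can happen only if `|Gᵢ| → ∞`" (for
  non-trivial `Gᵢ`; the trivial group meets the bound vacuously, `1 = 1^{3/2−o(1)}`), via a uniform
  gap `|S||T||U| < |G|^{3/2−ε(M)}` over all non-trivial groups of order `≤ M`
  (`exists_eps_tpp_card_lt_of_card_le`).
* §4 `not_meetsPackingBound_of_le` — the bridge from an effective bound
  `|S||T||U| ≤ C|G|^{3/2−δ} + |G|` (eventually, all TPP triples) to "does not meet the packing bound";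
  `BCGPU2023_cor33_seq` — Cor. 3.3 AS PRINTED (a sequence with `n(Gᵢ) ≥ c|Gᵢ|^δ` eventually does
  not meet the packing bound), from `BCGPU2023_thm32_holds`.
* §5 Fixed rank: `not_meetsPackingBound_GL` / `_SL` / `_PSL` — for `n ≥ 2` fixed and any sequence of
  finite fields `Fᵢ`, the sequences `GL_n(Fᵢ)`, `SL_n(Fᵢ)`, `PSL_n(Fᵢ)` do not meet the packing bound
  (§3.2 remark + footnote for `GL`; the bounded-rank sentence of the proof of Cor. 3.4 for types
  `SL`/`PSL`), from the tree's `n(G) ≥ q^{n−1}/4` bounds (`secondCharDegree_GL_ge`, `_SL_ge`, `_PSL_ge`).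
* §6 The §2 remark, both directions: `meetsPackingBound_of_violates` (a sequence of TPP triples
  violating Thm. 2.2's inequality at exponents `wᵢ → 2` meets the packing bound) and
  `exists_eps_noCertificate_of_not_meetsPackingBound` (a family of finite groups containing no
  sequence meeting the packing bound admits ONE `ε > 0` such that Thm. 2.2's inequality holds at
  `w = 2 + ε` for every TPP triple in every group of the family — the exact shape of the tree's
  `BCGPU2023_cor34_typeA`, `BCGPU2023_noCertificate_GL`, …, which are therefore faithful renderings
  of "cannot yield an upper bound on `ω` better than `2 + ε` via Thm. 2.2").

## Rendering and wording risks

* "`|Sᵢ||Tᵢ||Uᵢ| = |Gᵢ|^{3/2−o(1)}`" is rendered as: for every `ε > 0`, eventually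
  `|Gᵢ|^{3/2−ε} ≤ |Sᵢ||Tᵢ||Uᵢ|`.  Since `|S||T||U| ≤ |G|^{3/2}` for every TPP triple of non-empty sets
  (pairwise injectivity, tree `card_prod_sq_le_of_tpp`), this lower-bound reading is equivalent to the
  two-sided `= |G|^{3/2−o(1)}`; `MeetsPackingBound.exists_exponent` proves the literal form
  (`|Sᵢ||Tᵢ||Uᵢ| = |Gᵢ|^{3/2−eᵢ}` eventually with `eᵢ → 0`) and `MeetsPackingBound.of_exponent` the
  converse.  The TPP is required for every `i` (print: "subsets … satisfying the triple product
  property"); requiring it only eventually would be equivalent (pad with `{1},{1},{1}`), not done.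
* "`n(Gᵢ) ≥ Ω(|Gᵢ|^δ)`" is rendered `∃ c > 0`, eventually `c|Gᵢ|^δ ≤ n(Gᵢ)` with the tree's
  `secondCharDegree` (junk value `0` for abelian groups, so the hypothesis forces `Gᵢ` non-abelian,
  as Def. 3.1 presupposes: `exists_not_commute_of_secondCharDegree_ne_zero`).
* "a family of groups" (§2 remark) is rendered as a predicate `P` on finite groups
  (`P : ∀ G [Group G] [Fintype G], Prop`), a "sequence in the family" as `G : ℕ → Type` with
  `∀ i, P (Gᵢ)`; "can prove an upper bound on `ω` better than `2+ε` via Thm. 2.2" as "Thm. 2.2's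
  inequality FAILS at `w = 2 + ε`", i.e. `∑ⱼ dⱼ^{2+ε} < (|S||T||U|)^{(2+ε)/3}` (the reading used
  throughout `QuasirandomBarrier*.lean`).
* §5 is stated for `n ≥ 2`: `GL_1(𝔽_2)` is trivial and meets the bound vacuously; `GL_1`, abelian,
  is covered by Cohn–Umans' `|S||T||U| ≤ |G|` anyway.  The subgroup sentence of §3.2 is implied by
  the subset one (a subgroup triple with the TPP is a subset triple with the TPP); its effective form
  is the tree's `SubgroupTPP.card_mul_le_GL`.

WHAT THIS IS NOT: no statement about `ω`; nothing new about groups of unbounded rank (there Thm. 3.2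
alone does not exclude meeting the packing bound — the printed Cor. 3.4 uses class numbers, see
`QuasirandomBarrierLieTypeProofs.lean`); no Lie-group analogue (Def. 4.5).
-/

noncomputable section

open scoped BigOperators Topology
open Filter

namespace Literature.Barriers.MatrixMultiplication

open Literature.RepresentationTheory.FiniteGroups Literature.Combinatorics.Additive

/-! ## §1 BCGPU 2023, Def. 2.3: a sequence of finite groups meeting the packing bound -/

/-- **BCGPU 2023, Definition 2.3** ("We say a sequence `G₁, G₂, …` of finite groups *meets the packing
bound* if there exist subsets `Sᵢ`, `Tᵢ`, and `Uᵢ` of `Gᵢ` satisfying the triple product property such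
that `|Sᵢ| |Tᵢ| |Uᵢ| = |Gᵢ|^{3/2−o(1)}` as `i → ∞`"), for a sequence `G : ℕ → Type` of finite groups,
with the tree's `TripleProductProperty` (Cohn–Umans 2003, Def. 2.1) and the `o(1)` spelled out: for
every `ε > 0`, eventually `|Gᵢ|^{3/2−ε} ≤ |Sᵢ||Tᵢ||Uᵢ|` (equivalent to the two-sided reading because
`|S||T||U| ≤ |G|^{3/2}` always holds, see `MeetsPackingBound.exists_exponent`).
[cite: BlasiakCohnGrochowPrattUmans2023, Def. 2.3] -/
def MeetsPackingBound (G : ℕ → Type) [∀ i, Group (G i)] [∀ i, Fintype (G i)] : Prop :=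
  ∃ (S T U : ∀ i, Finset (G i)), (∀ i, TripleProductProperty (S i) (T i) (U i)) ∧
    ∀ ε : ℝ, 0 < ε → ∀ᶠ i in atTop,
      (Fintype.card (G i) : ℝ) ^ (3 / 2 - ε : ℝ) ≤ ((S i).card * (T i).card * (U i).card : ℕ)

/-! ## §2 Cohn–Umans 2003, Lemma 3.1 (strict part): the packing bound is never attained -/

section Strict

variable {G : Type} [Group G] [Fintype G]

/-- **Cohn–Umans 2003, Lemma 3.1 (proof)**: for a TPP triple `S, T, U` with `|U| ≥ 2` one has
`|S||T| < |G|` — "the map `(x,y) ↦ x⁻¹y` is injective on `S₁ × S₂` and its image intersects the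
quotient set `Q(S₃)` only in the identity. Thus `|G| ≥ n₁n₂`, and `|G| > n₁n₂` unless `n₃ = 1`."
(If `(s,t) ↦ s⁻¹t` were onto, `s⁻¹ u'u⁻¹ t'` would be of the form `s'⁻¹t`, and the TPP relation
`s s'⁻¹ · t t'⁻¹ · u u'⁻¹ = 1` would force `u = u'`.)  The tree's sharper Neumann inequality
`|S|(|T| + |U| − 1) ≤ |G|` (`TripleProductProperty.card_mul_le_neumann`) also implies this.
[cite: CohnUmans2003, Lemma 3.1] -/
theorem card_mul_card_lt_of_tpp {S T U : Finset G} (h : TripleProductProperty S T U)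
    (hU : 1 < U.card) : S.card * T.card < Fintype.card G := by
  classical
  obtain ⟨u, hu, u', hu', huu'⟩ := Finset.one_lt_card.1 hU
  have hle : S.card * T.card ≤ Fintype.card G := card_mul_card_le_of_tpp G h ⟨u, hu⟩
  refine lt_of_le_of_ne hle fun heq => huu' ?_
  -- `(s, t) ↦ s⁻¹ t` is injective on `S × T` (TPP with `u = u'`), hence onto `G` by counting
  have hinj : Set.InjOn (fun p : G × G => p.1⁻¹ * p.2) ↑(S ×ˢ T) := by
    rintro ⟨s, t⟩ hst ⟨s', t'⟩ hst' he
    simp only [Finset.coe_product, Set.mem_prod, Finset.mem_coe] at hst hst'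
    have he' : s⁻¹ * t = s'⁻¹ * t' := he
    have key : s' * s⁻¹ * (t * t'⁻¹) * (u * u⁻¹) = 1 := by
      calc s' * s⁻¹ * (t * t'⁻¹) * (u * u⁻¹) = s' * (s⁻¹ * t) * t'⁻¹ := by group
        _ = s' * (s'⁻¹ * t') * t'⁻¹ := by rw [he']
        _ = 1 := by group
    obtain ⟨h1, h2, -⟩ := h s' hst'.1 s hst.1 t hst.2 t' hst'.2 u hu u hu key
    exact Prod.ext h1.symm h2
  have hmaps : Set.MapsTo (fun p : G × G => p.1⁻¹ * p.2) ↑(S ×ˢ T) ↑(Finset.univ : Finset G) :=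
    fun _ _ => Finset.mem_coe.2 (Finset.mem_univ _)
  have hsurj := Finset.surjOn_of_injOn_of_card_le _ hmaps hinj
    (by rw [Finset.card_univ, Finset.card_product]; exact heq.ge)
  have hpos : 0 < S.card * T.card := by rw [heq]; exact Fintype.card_pos
  obtain ⟨s₀, hs₀⟩ : S.Nonempty := Finset.card_pos.1 (Nat.pos_of_ne_zero fun h0 => by
    rw [h0, zero_mul] at hpos; exact lt_irrefl 0 hpos)
  obtain ⟨t₀, ht₀⟩ : T.Nonempty := Finset.card_pos.1 (Nat.pos_of_ne_zero fun h0 => by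
    rw [h0, mul_zero] at hpos; exact lt_irrefl 0 hpos)
  obtain ⟨⟨s', t⟩, hmem, hval⟩ :=
    hsurj (Finset.mem_coe.2 (Finset.mem_univ (s₀⁻¹ * (u' * u⁻¹) * t₀)))
  simp only [Finset.coe_product, Set.mem_prod, Finset.mem_coe] at hmem
  have hval' : s'⁻¹ * t = s₀⁻¹ * (u' * u⁻¹) * t₀ := hval
  have key : s₀ * s'⁻¹ * (t * t₀⁻¹) * (u * u'⁻¹) = 1 := by
    calc s₀ * s'⁻¹ * (t * t₀⁻¹) * (u * u'⁻¹) = s₀ * (s'⁻¹ * t) * t₀⁻¹ * (u * u'⁻¹) := by group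
      _ = s₀ * (s₀⁻¹ * (u' * u⁻¹) * t₀) * t₀⁻¹ * (u * u'⁻¹) := by rw [hval']
      _ = 1 := by group
  exact (h s₀ hs₀ s' hmem.1 t hmem.2 t₀ ht₀ u hu u' hu' key).2.2

/-- **Cohn–Umans 2003, Lemma 3.1** ("the pseudo-exponent of a [non-trivial] finite group is always
greater than `2`", i.e. "`|G|³ > (n₁n₂n₃)²`"): in a non-trivial finite group every TPP triple has
`(|S||T||U|)² < |G|³`.  Proof as printed: the three pairwise packing bounds `|S||T|, |T||U|, |U||S|
≤ |G|` (tree `card_mul_card_le_of_tpp`), one of them strict by `card_mul_card_lt_of_tpp` unless all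
three sets are singletons (then `1 < |G|³`); empty sets give `0 < |G|³`.
[cite: CohnUmans2003, Lemma 3.1] -/
theorem card_prod_sq_lt_of_tpp [Nontrivial G] {S T U : Finset G} (h : TripleProductProperty S T U) :
    (S.card * T.card * U.card) ^ 2 < Fintype.card G ^ 3 := by
  have hG : 1 < Fintype.card G := Fintype.one_lt_card
  have hG0 : 0 < Fintype.card G := Fintype.card_pos
  have hG3 : 0 < Fintype.card G ^ 3 := pow_pos hG0 3
  rcases S.eq_empty_or_nonempty with hS | hS
  · simpa [hS] using hG3
  rcases T.eq_empty_or_nonempty with hT | hT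
  · simpa [hT] using hG3
  rcases U.eq_empty_or_nonempty with hU | hU
  · simpa [hU] using hG3
  have h1 := card_mul_card_le_of_tpp G h hU
  have h2 := card_mul_card_le_of_tpp G h.rotate hS
  have h3 := card_mul_card_le_of_tpp G h.rotate.rotate hT
  have hS1 := hS.card_pos
  have hT1 := hT.card_pos
  have hU1 := hU.card_pos
  have e : (S.card * T.card * U.card) ^ 2 =
      (S.card * T.card) * ((T.card * U.card) * (U.card * S.card)) := by ring
  have e3 : Fintype.card G ^ 3 = Fintype.card G * (Fintype.card G * Fintype.card G) := by ring
  rw [e, e3]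
  by_cases hU2 : 1 < U.card
  · exact Nat.mul_lt_mul_of_lt_of_le (card_mul_card_lt_of_tpp h hU2) (Nat.mul_le_mul h2 h3)
      (Nat.mul_pos hG0 hG0)
  by_cases hS2 : 1 < S.card
  · have k := card_mul_card_lt_of_tpp h.rotate hS2
    exact Nat.mul_lt_mul_of_le_of_lt h1 (Nat.mul_lt_mul_of_lt_of_le k h3 hG0) hG0
  by_cases hT2 : 1 < T.card
  · have k := card_mul_card_lt_of_tpp h.rotate.rotate hT2
    exact Nat.mul_lt_mul_of_le_of_lt h1 (Nat.mul_lt_mul_of_le_of_lt h2 k hG0) hG0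
  -- all three sets are singletons
  have hS' : S.card = 1 := by omega
  have hT' : T.card = 1 := by omega
  have hU' : U.card = 1 := by omega
  rw [hS', hT', hU']
  have : 1 < Fintype.card G * Fintype.card G := by nlinarith
  simpa using Nat.mul_lt_mul_of_lt_of_le hG this.le (Nat.mul_pos hG0 hG0)

/-- `N² < g³` in `ℕ` gives `N < g^{3/2}` in `ℝ`. [folklore] -/
private theorem cast_lt_rpow_of_sq_lt {N g : ℕ} (h : N ^ 2 < g ^ 3) :
    (N : ℝ) < (g : ℝ) ^ (3 / 2 : ℝ) := by
  have hg : (0 : ℝ) ≤ g := Nat.cast_nonneg g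
  have e : ((g : ℝ) ^ (3 / 2 : ℝ)) ^ (2 : ℕ) = ((g ^ 3 : ℕ) : ℝ) := by
    rw [← Real.rpow_natCast, ← Real.rpow_mul hg, Nat.cast_pow,
      show (3 / 2 : ℝ) * ((2 : ℕ) : ℝ) = ((3 : ℕ) : ℝ) by norm_num, Real.rpow_natCast]
  refine lt_of_pow_lt_pow_left₀ 2 (by positivity) ?_
  rw [e]
  exact_mod_cast h

/-- **The packing bound is never attained** (Cohn–Umans 2003, Lemma 3.1, real form): in a non-trivial
finite group every TPP triple has `|S||T||U| < |G|^{3/2}`. [cite: CohnUmans2003, Lemma 3.1] -/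
theorem tpp_card_lt_card_rpow [Nontrivial G] {S T U : Finset G} (h : TripleProductProperty S T U) :
    ((S.card * T.card * U.card : ℕ) : ℝ) < (Fintype.card G : ℝ) ^ (3 / 2 : ℝ) :=
  cast_lt_rpow_of_sq_lt (card_prod_sq_lt_of_tpp h)

end Strict

/-! ## §3 Meeting the packing bound forces `|Gᵢ| → ∞` -/

section Growth

/-- A uniform gap below the packing bound for bounded orders: for every `M` there is `ε > 0` with
`N < g^{3/2−ε}` whenever `g ≤ M` and `N² < g³` (finitely many pairs, each with a gap by continuity
of `ε ↦ g^{3/2−ε}`). [folklore] -/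
private theorem exists_eps_forall_lt_rpow (M : ℕ) :
    ∃ ε : ℝ, 0 < ε ∧ ∀ g N : ℕ, g ≤ M → N ^ 2 < g ^ 3 → (N : ℝ) < (g : ℝ) ^ (3 / 2 - ε : ℝ) := by
  set I : Finset (ℕ × ℕ) := Finset.range (M + 1) ×ˢ Finset.range (M ^ 3 + 1) with hI
  have key : ∀ p ∈ I, ∀ᶠ ε in 𝓝 (0 : ℝ),
      (p.2 ^ 2 < p.1 ^ 3 → (p.2 : ℝ) < (p.1 : ℝ) ^ (3 / 2 - ε : ℝ)) := by
    rintro ⟨g, N⟩ -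
    by_cases hlt : N ^ 2 < g ^ 3
    · have hg0 : g ≠ 0 := by
        rintro rfl
        simp at hlt
      have hg : (g : ℝ) ≠ 0 := by exact_mod_cast hg0
      have hcont : Tendsto (fun ε : ℝ => (g : ℝ) ^ (3 / 2 - ε : ℝ)) (𝓝 0)
          (𝓝 ((g : ℝ) ^ (3 / 2 - 0 : ℝ))) :=
        (Real.continuousAt_const_rpow hg).tendsto.comp
          ((continuous_const.sub continuous_id).tendsto 0)
      have h0 : (N : ℝ) < (g : ℝ) ^ (3 / 2 - 0 : ℝ) := by
        rw [sub_zero]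
        exact cast_lt_rpow_of_sq_lt hlt
      exact (hcont.eventually_const_lt h0).mono fun ε hε _ => hε
    · exact Eventually.of_forall fun ε h' => absurd h' hlt
  rw [← Filter.eventually_all_finset] at key
  have key' : ∀ᶠ ε in 𝓝[>] (0 : ℝ), ε ∈ Set.Ioi (0 : ℝ) ∧ ∀ p ∈ I,
      (p.2 ^ 2 < p.1 ^ 3 → (p.2 : ℝ) < (p.1 : ℝ) ^ (3 / 2 - ε : ℝ)) :=
    eventually_mem_nhdsWithin.and (key.filter_mono nhdsWithin_le_nhds)
  obtain ⟨ε, hε, hall⟩ := key'.exists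
  refine ⟨ε, hε, fun g N hg hlt => hall (g, N) ?_ hlt⟩
  have hN : N ≤ M ^ 3 := by
    have h1 : N ≤ N ^ 2 := by nlinarith
    have h2 : g ^ 3 ≤ M ^ 3 := Nat.pow_le_pow_left hg 3
    omega
  rw [hI, Finset.mem_product, Finset.mem_range, Finset.mem_range]
  exact ⟨by omega, by omega⟩

/-- The same gap for TPP triples: for every `M` there is `ε > 0` such that in every NON-TRIVIAL
finite group of order `≤ M` every TPP triple has `|S||T||U| < |G|^{3/2−ε}`
(`card_prod_sq_lt_of_tpp` + a finite minimum over the pairs `(|G|, |S||T||U|)`, by continuity of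
`ε ↦ g^{3/2−ε}`). [cite: CohnUmans2003, Lemma 3.1] -/
theorem exists_eps_tpp_card_lt_of_card_le (M : ℕ) :
    ∃ ε : ℝ, 0 < ε ∧ ∀ (G : Type) [Group G] [Fintype G] [Nontrivial G], Fintype.card G ≤ M →
      ∀ S T U : Finset G, TripleProductProperty S T U →
        ((S.card * T.card * U.card : ℕ) : ℝ) < (Fintype.card G : ℝ) ^ (3 / 2 - ε : ℝ) := by
  obtain ⟨ε, hε, h⟩ := exists_eps_forall_lt_rpow M
  exact ⟨ε, hε, fun G _ _ _ hM S T U hTPP => h _ _ hM (card_prod_sq_lt_of_tpp hTPP)⟩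

/-- **"A simple argument [Cohn–Umans 2003] shows that this can happen only if `|Gᵢ| → ∞`"**
(BCGPU 2023, after Def. 2.3): a sequence of NON-TRIVIAL finite groups meeting the packing bound has
`|Gᵢ| → ∞`.  (Non-triviality is needed: the constant trivial sequence meets the bound with
`Sᵢ = Tᵢ = Uᵢ = {1}`, `1 = 1^{3/2−ε}`.)
[cite: BlasiakCohnGrochowPrattUmans2023, Def. 2.3 (remark following it)] [cite: CohnUmans2003, Lemma 3.1] -/
theorem MeetsPackingBound.tendsto_card_atTop {G : ℕ → Type} [∀ i, Group (G i)] [∀ i, Fintype (G i)]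
    (h : MeetsPackingBound G) (hG : ∀ᶠ i in atTop, Nontrivial (G i)) :
    Tendsto (fun i => Fintype.card (G i)) atTop atTop := by
  obtain ⟨S, T, U, hTPP, hPB⟩ := h
  refine tendsto_atTop.2 fun M => ?_
  obtain ⟨ε, hε, hsmall⟩ := exists_eps_tpp_card_lt_of_card_le M
  filter_upwards [hG, hPB ε hε] with i hiG hiP
  by_contra hlt
  push Not at hlt
  haveI := hiG
  exact absurd hiP (not_le.2 (hsmall (G i) hlt.le (S i) (T i) (U i) (hTPP i)))

end Growth

/-! ## §4 From an effective bound to "does not meet the packing bound"; Cor. 3.3 as printed -/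

section Cor33

/-- **The bridge.**  If, eventually in `i`, every TPP triple of `Gᵢ` satisfies
`|S||T||U| ≤ C|Gᵢ|^{3/2−δ} + |Gᵢ|` for fixed `C` and `δ > 0` (the shape of Thm. 3.2 / Cor. 3.3 /
the `GL` bounds in the tree), and the `Gᵢ` are eventually non-trivial, then the sequence does not
meet the packing bound: large `|Gᵢ|` are excluded by the bound (with `ε = min(δ, 1/2)/2`), bounded
`|Gᵢ|` by the uniform gap `exists_eps_tpp_card_lt_of_card_le`.
[cite: BlasiakCohnGrochowPrattUmans2023, Cor. 3.3 (proof: "We immediately obtain")] -/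
theorem not_meetsPackingBound_of_le (G : ℕ → Type) [∀ i, Group (G i)] [∀ i, Fintype (G i)]
    (hG : ∀ᶠ i in atTop, Nontrivial (G i)) {C δ : ℝ} (hδ : 0 < δ)
    (hB : ∀ᶠ i in atTop, ∀ S T U : Finset (G i), TripleProductProperty S T U →
      ((S.card * T.card * U.card : ℕ) : ℝ) ≤
        C * (Fintype.card (G i) : ℝ) ^ (3 / 2 - δ : ℝ) + Fintype.card (G i)) :
    ¬ MeetsPackingBound G := by
  rintro ⟨S, T, U, hTPP, hPB⟩
  -- exponents: `δ' = min δ (1/2)`, `ε₀ = δ'/2`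
  set δ' : ℝ := min δ (1 / 2) with hδ'
  have hδ'0 : 0 < δ' := lt_min hδ (by norm_num)
  have hδ'δ : δ' ≤ δ := min_le_left _ _
  have hδ'h : δ' ≤ 1 / 2 := min_le_right _ _
  set ε₀ : ℝ := δ' / 2 with hε₀
  have hε₀0 : 0 < ε₀ := by positivity
  -- threshold `g₀`: `|C| + 1 < g^{ε₀}` for `g ≥ g₀`
  have hthr : ∀ᶠ g : ℕ in atTop, |C| + 1 < (g : ℝ) ^ ε₀ :=
    ((tendsto_rpow_atTop hε₀0).comp tendsto_natCast_atTop_atTop).eventually_gt_atTop (|C| + 1)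
  obtain ⟨g₀, hg₀⟩ := eventually_atTop.1 hthr
  -- small groups: uniform gap below order `g₀`
  obtain ⟨ε₁, hε₁, hsmall⟩ := exists_eps_tpp_card_lt_of_card_le g₀
  set ε : ℝ := min ε₀ ε₁ with hεdef
  have hε0 : 0 < ε := lt_min hε₀0 hε₁
  have hεε₀ : ε ≤ ε₀ := min_le_left _ _
  have hεε₁ : ε ≤ ε₁ := min_le_right _ _
  obtain ⟨i, hiG, hiB, hiP⟩ := (hG.and (hB.and (hPB ε hε0))).exists
  haveI := hiG
  set g : ℕ := Fintype.card (G i) with hg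
  have hg1 : (1 : ℝ) ≤ g := by exact_mod_cast (Fintype.card_pos : 0 < g)
  have hg0 : (0 : ℝ) < g := by linarith
  have hlt : (((S i).card * (T i).card * (U i).card : ℕ) : ℝ) < (g : ℝ) ^ (3 / 2 - ε : ℝ) := by
    rcases lt_or_ge g g₀ with hlt | hge
    · exact (hsmall (G i) hlt.le (S i) (T i) (U i) (hTPP i)).trans_le
        (Real.rpow_le_rpow_of_exponent_le hg1 (by linarith))
    · have hC := hiB (S i) (T i) (U i) (hTPP i)
      have hgε : |C| + 1 < (g : ℝ) ^ ε₀ := hg₀ g hge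
      have h1 : C * (g : ℝ) ^ (3 / 2 - δ : ℝ) ≤ |C| * (g : ℝ) ^ (3 / 2 - δ' : ℝ) :=
        calc C * (g : ℝ) ^ (3 / 2 - δ : ℝ) ≤ |C| * (g : ℝ) ^ (3 / 2 - δ : ℝ) :=
              mul_le_mul_of_nonneg_right (le_abs_self C) (by positivity)
          _ ≤ |C| * (g : ℝ) ^ (3 / 2 - δ' : ℝ) :=
              mul_le_mul_of_nonneg_left (Real.rpow_le_rpow_of_exponent_le hg1 (by linarith))
                (abs_nonneg C)
      have h2 : (g : ℝ) ≤ (g : ℝ) ^ (3 / 2 - δ' : ℝ) :=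
        calc (g : ℝ) = (g : ℝ) ^ (1 : ℝ) := (Real.rpow_one _).symm
          _ ≤ (g : ℝ) ^ (3 / 2 - δ' : ℝ) := Real.rpow_le_rpow_of_exponent_le hg1 (by linarith)
      have h3 : (g : ℝ) ^ (3 / 2 - δ' : ℝ) * (g : ℝ) ^ ε₀ = (g : ℝ) ^ (3 / 2 - ε₀ : ℝ) := by
        rw [← Real.rpow_add hg0]
        congr 1
        rw [hε₀]
        ring
      have hX : (0 : ℝ) < (g : ℝ) ^ (3 / 2 - δ' : ℝ) := by positivity
      have h4 : (((S i).card * (T i).card * (U i).card : ℕ) : ℝ) ≤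
          (|C| + 1) * (g : ℝ) ^ (3 / 2 - δ' : ℝ) := by linarith [hC, h1, h2]
      have h5 : (|C| + 1) * (g : ℝ) ^ (3 / 2 - δ' : ℝ) < (g : ℝ) ^ (3 / 2 - ε₀ : ℝ) := by
        rw [← h3]
        nlinarith [hgε, hX]
      calc (((S i).card * (T i).card * (U i).card : ℕ) : ℝ)
          ≤ (|C| + 1) * (g : ℝ) ^ (3 / 2 - δ' : ℝ) := h4
        _ < (g : ℝ) ^ (3 / 2 - ε₀ : ℝ) := h5
        _ ≤ (g : ℝ) ^ (3 / 2 - ε : ℝ) := Real.rpow_le_rpow_of_exponent_le hg1 (by linarith)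
  exact absurd hiP (not_le.2 hlt)

/-- `n(G) ≠ 0` forces `G` non-abelian (the tree's `secondCharDegree` is `sInf` of the degrees `> 1`,
all degrees of an abelian group being `1`: Serre 1977, §3.1 Thm. 9, tree `Serre1977_thm9_holds`).
[cite: BlasiakCohnGrochowPrattUmans2023, Def. 3.1] -/
theorem exists_not_commute_of_secondCharDegree_ne_zero {G : Type} [Group G] [Finite G]
    (h : secondCharDegree G ≠ 0) : ∃ a b : G, a * b ≠ b * a := by
  by_contra hc
  push Not at hc
  have hone := (Serre1977_thm9_holds G).1 hc
  apply h
  unfold secondCharDegree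
  rw [Nat.sInf_eq_zero]
  right
  ext d
  simp only [Set.mem_setOf_eq, Set.mem_empty_iff_false, iff_false, not_and, not_lt]
  intro hd
  rw [hone d hd]

/-- Non-abelian groups are non-trivial. [folklore] -/
private theorem nontrivial_of_exists_not_commute {G : Type} [Group G]
    (h : ∃ a b : G, a * b ≠ b * a) : Nontrivial G := by
  obtain ⟨a, b, hab⟩ := h
  exact ⟨⟨a, 1, fun ha => hab (by rw [ha, one_mul, mul_one])⟩⟩

/-- **BCGPU 2023, Corollary 3.3, as printed**: "No sequence `G₁, G₂, …` of finite groups satisfying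
`n(Gᵢ) ≥ Ω(|Gᵢ|^δ)` with `δ > 0` can meet the packing bound."  Hypothesis rendered: `c > 0`, `δ > 0`
and eventually `c|Gᵢ|^δ ≤ n(Gᵢ)` (`secondCharDegree`; this forces `Gᵢ` non-abelian).  From the
PROVED Thm. 3.2 in its Cor. 3.3 form (`BCGPU2023_thm32_holds.cor33`:
`|S||T||U| ≤ |G|^{3/2−δ/2}/√c + |G|`) and the bridge `not_meetsPackingBound_of_le`.
[cite: BlasiakCohnGrochowPrattUmans2023, Cor. 3.3] -/
theorem BCGPU2023_cor33_seq (G : ℕ → Type) [∀ i, Group (G i)] [∀ i, Fintype (G i)]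
    {c δ : ℝ} (hc : 0 < c) (hδ : 0 < δ)
    (hn : ∀ᶠ i in atTop, c * (Fintype.card (G i) : ℝ) ^ δ ≤ secondCharDegree (G i)) :
    ¬ MeetsPackingBound G := by
  have hG : ∀ᶠ i in atTop, ∃ a b : G i, a * b ≠ b * a := by
    filter_upwards [hn] with i hi
    refine exists_not_commute_of_secondCharDegree_ne_zero fun h0 => ?_
    have hpos : 0 < c * (Fintype.card (G i) : ℝ) ^ δ :=
      mul_pos hc (Real.rpow_pos_of_pos (by exact_mod_cast Fintype.card_pos) δ)
    rw [h0, Nat.cast_zero] at hi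
    linarith
  refine not_meetsPackingBound_of_le G (hG.mono fun i hi => nontrivial_of_exists_not_commute hi)
    (C := 1 / Real.sqrt c) (δ := δ / 2) (by positivity) ?_
  filter_upwards [hG, hn] with i hiG hin S T U hTPP
  have h := BCGPU2023_thm32_holds.cor33 (G i) hiG hc hin S T U hTPP
  calc ((S.card * T.card * U.card : ℕ) : ℝ)
      ≤ (Fintype.card (G i) : ℝ) ^ (3 / 2 - δ / 2 : ℝ) / Real.sqrt c + Fintype.card (G i) := h
    _ = 1 / Real.sqrt c * (Fintype.card (G i) : ℝ) ^ (3 / 2 - δ / 2 : ℝ) + Fintype.card (G i) := by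
        ring

end Cor33

/-! ## §5 Fixed rank: `GL_n(Fᵢ)`, `SL_n(Fᵢ)`, `PSL_n(Fᵢ)` do not meet the packing bound -/

section FixedRank

/-- From the `q`-parametrised inputs `q^m/4 ≤ n(G)` and `|G| ≤ q^d` (`d ≥ 1`) to the `|G|^δ` form of
Cor. 3.3: `(1/4)|G|^{m/d} ≤ n(G)`. [cite: BlasiakCohnGrochowPrattUmans2023, Cor. 3.4 (proof, bounded rank)] -/
theorem secondCharDegree_ge_rpow_of_card_le {G : Type} [Group G] [Fintype G] {q m d : ℕ}
    (hd : 0 < d) (hn : (q : ℝ) ^ m / 4 ≤ secondCharDegree G) (hcard : Fintype.card G ≤ q ^ d) :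
    (1 / 4 : ℝ) * (Fintype.card G : ℝ) ^ ((m : ℝ) / d) ≤ secondCharDegree G := by
  have hq0 : (0 : ℝ) ≤ q := Nat.cast_nonneg _
  have hG0 : (0 : ℝ) ≤ Fintype.card G := Nat.cast_nonneg _
  have hdR : (0 : ℝ) < (d : ℝ) := by exact_mod_cast hd
  have hcardR : (Fintype.card G : ℝ) ≤ (q : ℝ) ^ d := by exact_mod_cast hcard
  have h1 : (Fintype.card G : ℝ) ^ ((m : ℝ) / d) ≤ ((q : ℝ) ^ d) ^ ((m : ℝ) / d) :=
    Real.rpow_le_rpow hG0 hcardR (by positivity)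
  have h2 : ((q : ℝ) ^ d) ^ ((m : ℝ) / d) = (q : ℝ) ^ m := by
    rw [← Real.rpow_natCast, ← Real.rpow_mul hq0, mul_div_cancel₀ _ hdR.ne', Real.rpow_natCast]
  rw [h2] at h1
  linarith

variable (F : ℕ → Type) [∀ i, Field (F i)] [∀ i, Fintype (F i)] [∀ i, DecidableEq (F i)]

/-- **BCGPU 2023, §3.2** (p. 7, footnote before Cor. 3.8: in `GL(n, q)` with `n` fixed "arbitrary
subsets cannot meet the packing bound"; a fortiori the paragraph's "triples of subgroups in `GL(n,q)`
with fixed `n` cannot meet the packing bound"): for `n ≥ 2` and ANY sequence of finite fields `Fᵢ`,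
the sequence `GL_n(Fᵢ)` does not meet the packing bound.  From the tree's effective
`tpp_card_le_GL_rpow` (`|S||T||U| ≤ 2|G|^{3/2 − (n−1)/(2n²)} + |G|`).  (`n = 1`: `GL_1(𝔽_2)` is trivial
and meets the bound vacuously, see the module docstring.)
[cite: BlasiakCohnGrochowPrattUmans2023, §3.2 (paragraph and footnote before Cor. 3.8)] -/
theorem not_meetsPackingBound_GL {n : ℕ} (hn : 2 ≤ n) :
    ¬ MeetsPackingBound (fun i => GL (Fin n) (F i)) := by
  obtain ⟨m, rfl⟩ : ∃ m, n = m + 1 := ⟨n - 1, by omega⟩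
  have hm : 1 ≤ m := by omega
  refine not_meetsPackingBound_of_le _
    (Eventually.of_forall fun i => nontrivial_of_exists_not_commute (GLn.exists_not_commute hm))
    (C := 2) (δ := (m : ℝ) / ((m + 1) * (m + 1) : ℕ) / 2) (by positivity)
    (Eventually.of_forall fun i S T U hTPP => ?_)
  exact tpp_card_le_GL_rpow hm S T U hTPP

/-- `|SL_{m+1}(F)| ≤ q^{(m+1)²}` (a subset of the `(m+1) × (m+1)` matrices). [folklore] -/
private theorem card_SL_le' {K : Type} [Field K] [Fintype K] [DecidableEq K] (m : ℕ) :
    Fintype.card (Matrix.SpecialLinearGroup (Fin (m + 1)) K) ≤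
      Fintype.card K ^ ((m + 1) * (m + 1)) := by
  calc Fintype.card (Matrix.SpecialLinearGroup (Fin (m + 1)) K)
      ≤ Fintype.card (Matrix (Fin (m + 1)) (Fin (m + 1)) K) :=
        Fintype.card_le_of_injective _ Subtype.val_injective
    _ = Fintype.card K ^ ((m + 1) * (m + 1)) := by
        change Fintype.card (Fin (m + 1) → Fin (m + 1) → K) = _
        rw [Fintype.card_fun, Fintype.card_fun, Fintype.card_fin, ← pow_mul, mul_comm]

/-- **BCGPU 2023, Cor. 3.4 (proof), bounded rank, type `A`**: "groups of Lie type of bounded rank …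
satisfy `n(G) ≥ Ω(|G|^δ)` for some constant `δ > 0` … and this condition suffices by Cor. 3.3" — for
`n ≥ 2` fixed and any sequence of finite fields `Fᵢ`, the sequence `SL_n(Fᵢ)` does not meet the
packing bound (Landazuri–Seitz in the tree: `secondCharDegree_SL_ge`, `n(SL_n(q)) ≥ q^{n−1}/4
≥ (1/4)|SL_n(q)|^{(n−1)/n²}`, then `BCGPU2023_cor33_seq`).
[cite: BlasiakCohnGrochowPrattUmans2023, Cor. 3.4 (proof, first paragraph) and Cor. 3.3] -/
theorem not_meetsPackingBound_SL {n : ℕ} (hn : 2 ≤ n) :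
    ¬ MeetsPackingBound (fun i => Matrix.SpecialLinearGroup (Fin n) (F i)) := by
  obtain ⟨m, rfl⟩ : ∃ m, n = m + 1 := ⟨n - 1, by omega⟩
  have hm : 1 ≤ m := by omega
  refine BCGPU2023_cor33_seq _ (c := 1 / 4) (δ := (m : ℝ) / ((m + 1) * (m + 1) : ℕ))
    (by norm_num) (by positivity) (Eventually.of_forall fun i => ?_)
  exact secondCharDegree_ge_rpow_of_card_le (by positivity) (secondCharDegree_SL_ge hm)
    (card_SL_le' m)

/-- The same for the simple quotients `PSL_n(Fᵢ)` ("also for simple groups that are quotients of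
groups of Lie type by their centers", p. 7), from the tree's `secondCharDegree_PSL_ge` and
`|PSL| ≤ |SL| ≤ q^{n²}`.
[cite: BlasiakCohnGrochowPrattUmans2023, Cor. 3.4 (proof, first paragraph, and the remark following the proof)] -/
theorem not_meetsPackingBound_PSL {n : ℕ} (hn : 2 ≤ n) :
    ¬ MeetsPackingBound (fun i => Matrix.ProjectiveSpecialLinearGroup (Fin n) (F i)) := by
  obtain ⟨m, rfl⟩ : ∃ m, n = m + 1 := ⟨n - 1, by omega⟩
  have hm : 1 ≤ m := by omega
  refine BCGPU2023_cor33_seq _ (c := 1 / 4) (δ := (m : ℝ) / ((m + 1) * (m + 1) : ℕ))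
    (by norm_num) (by positivity) (Eventually.of_forall fun i => ?_)
  refine secondCharDegree_ge_rpow_of_card_le (by positivity) (secondCharDegree_PSL_ge hm) ?_
  exact (Fintype.card_le_of_surjective _ (QuotientGroup.mk_surjective)).trans (card_SL_le' m)

end FixedRank

/-! ## §6 The §2 remark: the packing bound and certificates via Thm. 2.2 -/

section Remark

/-- **BCGPU 2023, §2** ("Meeting the packing bound is a necessary condition for Thm. 2.2 to yield
`ω = 2`"): if TPP triples `Sᵢ, Tᵢ, Uᵢ ⊆ Gᵢ` VIOLATE the inequality of Thm. 2.2 at exponents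
`wᵢ ≥ 2` with `wᵢ → 2` (eventually `∑ⱼ dⱼ^{wᵢ} < (|Sᵢ||Tᵢ||Uᵢ|)^{wᵢ/3}` — the only way Thm. 2.2 can
certify bounds `ω < wᵢ` approaching `2`), then the sequence meets the packing bound: `|G| ≤ ∑ⱼ dⱼ^w`
(tree `card_le_charDegreePowSum`) gives `|Gᵢ|^{3/wᵢ} < |Sᵢ||Tᵢ||Uᵢ|` and `3/wᵢ → 3/2`.
[cite: BlasiakCohnGrochowPrattUmans2023, §2 (remark after Def. 2.3)] -/
theorem meetsPackingBound_of_violates (G : ℕ → Type) [∀ i, Group (G i)] [∀ i, Fintype (G i)]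
    (S T U : ∀ i, Finset (G i)) (hTPP : ∀ i, TripleProductProperty (S i) (T i) (U i))
    (w : ℕ → ℝ) (hw2 : ∀ i, 2 ≤ w i) (hw : Tendsto w atTop (𝓝 2))
    (hviol : ∀ᶠ i in atTop,
      charDegreePowSum (G i) (w i) < (((S i).card * (T i).card * (U i).card : ℕ) : ℝ) ^ (w i / 3)) :
    MeetsPackingBound G := by
  refine ⟨S, T, U, hTPP, fun ε hε => ?_⟩
  have hwε : ∀ᶠ i in atTop, w i < 2 + ε := hw.eventually_lt_const (by linarith)
  filter_upwards [hviol, hwε] with i hiv hiw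
  set g : ℝ := (Fintype.card (G i) : ℝ) with hg
  set N : ℝ := (((S i).card * (T i).card * (U i).card : ℕ) : ℝ) with hN
  have hg1 : (1 : ℝ) ≤ g := by rw [hg]; exact_mod_cast Fintype.card_pos
  have hN0 : (0 : ℝ) ≤ N := by rw [hN]; exact Nat.cast_nonneg _
  have hwi := hw2 i
  have hw0 : 0 < w i := by linarith
  -- `g ≤ Σ d^w < N^{w/3}`, hence `g^{3/w} < N`
  have h1 : g < N ^ (w i / 3) := (card_le_charDegreePowSum (G i) hwi).trans_lt hiv
  have h2 : g ^ (3 / w i) < N := by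
    have h0 : (0 : ℝ) ≤ g := by linarith
    have := Real.rpow_lt_rpow h0 h1 (by positivity : (0 : ℝ) < 3 / w i)
    rwa [← Real.rpow_mul hN0, show w i / 3 * (3 / w i) = 1 by field_simp, Real.rpow_one] at this
  -- `3/2 - ε ≤ 3/w` since `w < 2 + ε`
  have h3 : (3 / 2 - ε : ℝ) ≤ 3 / w i := by
    rw [le_div_iff₀ hw0]
    nlinarith
  exact (Real.rpow_le_rpow_of_exponent_le hg1 h3).trans h2.le

/-- **BCGPU 2023, §2** ("if a family of groups contains no sequence meeting the packing bound, then
there is a constant `ε > 0` such that no group in the family can prove an upper bound on `ω` better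
than `2 + ε` via Thm. 2.2"): for a family `P` of finite groups none of whose sequences meets the
packing bound there is ONE `ε > 0` such that Thm. 2.2's inequality HOLDS at `w = 2 + ε`,
`(|S||T||U|)^{(2+ε)/3} ≤ ∑ⱼ dⱼ^{2+ε}`, for every TPP triple in every group of the family.  Proof:
otherwise pick, for `εᵢ = 1/(i+1)`, a violating group `Gᵢ` of the family; by
`meetsPackingBound_of_violates` the sequence `(Gᵢ)` meets the packing bound.  This is the precise
sense in which the tree's `∃ ε > 0, … (|S||T||U|)^{(2+ε)/3} ≤ charDegreePowSum G (2+ε)` statements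
(`BCGPU2023_cor34_typeA`, `BCGPU2023_noCertificate_GL`, …) render "cannot prove `ω < 2 + ε`".
[cite: BlasiakCohnGrochowPrattUmans2023, §2 (remark after Def. 2.3)] -/
theorem exists_eps_noCertificate_of_not_meetsPackingBound
    (P : ∀ (G : Type) [Group G] [Fintype G], Prop)
    (hP : ∀ (G : ℕ → Type) [∀ i, Group (G i)] [∀ i, Fintype (G i)],
      (∀ i, P (G i)) → ¬ MeetsPackingBound G) :
    ∃ ε : ℝ, 0 < ε ∧ ∀ (G : Type) [Group G] [Fintype G], P G →
      ∀ S T U : Finset G, TripleProductProperty S T U →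
        ((S.card * T.card * U.card : ℕ) : ℝ) ^ ((2 + ε) / 3) ≤ charDegreePowSum G (2 + ε) := by
  by_contra h
  push Not at h
  have h' := fun i : ℕ => h (1 / ((i : ℝ) + 1)) (by positivity)
  choose G instG instF hPG S T U hTPP hlt using h'
  letI : ∀ i, Group (G i) := instG
  letI : ∀ i, Fintype (G i) := instF
  refine hP G hPG (meetsPackingBound_of_violates G S T U hTPP (fun i => 2 + 1 / ((i : ℝ) + 1))
    (fun i => by simp only [le_add_iff_nonneg_right]; positivity) ?_ (Eventually.of_forall hlt))
  simpa using tendsto_const_nhds.add (tendsto_one_div_add_atTop_nhds_zero_nat (𝕜 := ℝ))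

end Remark

/-! ## §7 The literal `|Gᵢ|^{3/2−o(1)}` form of Def. 2.3 -/

section Exponent

variable {G : ℕ → Type} [∀ i, Group (G i)] [∀ i, Fintype (G i)]

/-- From the literal form to `MeetsPackingBound`: if TPP triples satisfy, eventually,
`|Sᵢ||Tᵢ||Uᵢ| = |Gᵢ|^{3/2−eᵢ}` with `eᵢ → 0`, the sequence meets the packing bound.
[cite: BlasiakCohnGrochowPrattUmans2023, Def. 2.3] -/
theorem MeetsPackingBound.of_exponent (S T U : ∀ i, Finset (G i))
    (hTPP : ∀ i, TripleProductProperty (S i) (T i) (U i)) (e : ℕ → ℝ)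
    (he : Tendsto e atTop (𝓝 0))
    (heq : ∀ᶠ i in atTop, (((S i).card * (T i).card * (U i).card : ℕ) : ℝ) =
      (Fintype.card (G i) : ℝ) ^ (3 / 2 - e i : ℝ)) :
    MeetsPackingBound G := by
  refine ⟨S, T, U, hTPP, fun ε hε => ?_⟩
  filter_upwards [heq, he.eventually_lt_const hε] with i hi hei
  have hg1 : (1 : ℝ) ≤ Fintype.card (G i) := by exact_mod_cast Fintype.card_pos
  rw [hi]
  exact Real.rpow_le_rpow_of_exponent_le hg1 (by linarith)

/-- From `MeetsPackingBound` to the literal form: there are TPP triples and exponents `eᵢ → 0` with,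
eventually, `|Sᵢ||Tᵢ||Uᵢ| = |Gᵢ|^{3/2−eᵢ}` (take `eᵢ = 3/2 − log_{|Gᵢ|}(|Sᵢ||Tᵢ||Uᵢ|)`, which is
`≥ 0` by the packing bound `|S||T||U| ≤ |G|^{3/2}` and eventually `≤ ε` by hypothesis; `eᵢ = 0`
when `|Gᵢ| = 1`). [cite: BlasiakCohnGrochowPrattUmans2023, Def. 2.3] -/
theorem MeetsPackingBound.exists_exponent (h : MeetsPackingBound G) :
    ∃ (S T U : ∀ i, Finset (G i)), (∀ i, TripleProductProperty (S i) (T i) (U i)) ∧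
      ∃ e : ℕ → ℝ, Tendsto e atTop (𝓝 0) ∧ ∀ᶠ i in atTop,
        (((S i).card * (T i).card * (U i).card : ℕ) : ℝ) =
          (Fintype.card (G i) : ℝ) ^ (3 / 2 - e i : ℝ) := by
  obtain ⟨S, T, U, hTPP, hPB⟩ := h
  refine ⟨S, T, U, hTPP, ?_⟩
  -- the exponent
  let N : ℕ → ℝ := fun i => (((S i).card * (T i).card * (U i).card : ℕ) : ℝ)
  let g : ℕ → ℝ := fun i => (Fintype.card (G i) : ℝ)
  let e : ℕ → ℝ := fun i => if 1 < g i then 3 / 2 - Real.logb (g i) (N i) else 0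
  have hg1 : ∀ i, (1 : ℝ) ≤ g i := fun i => by
    change (1 : ℝ) ≤ (Fintype.card (G i) : ℝ)
    exact_mod_cast Fintype.card_pos
  -- eventually `N i ≥ 1` (from the hypothesis with `ε = 1`), hence the sets are non-empty
  have hN1 : ∀ᶠ i in atTop, (1 : ℝ) ≤ N i := by
    filter_upwards [hPB 1 one_pos] with i hi
    exact (Real.one_le_rpow (hg1 i) (by norm_num)).trans hi
  -- upper packing bound `N ≤ g^{3/2}` once `N ≥ 1`
  have hNle : ∀ i, (1 : ℝ) ≤ N i → N i ≤ g i ^ (3 / 2 : ℝ) := by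
    intro i hi
    have hne : ((S i).card * (T i).card * (U i).card) ≠ 0 := by
      intro h0
      have : N i = 0 := by
        change (((S i).card * (T i).card * (U i).card : ℕ) : ℝ) = 0
        rw [h0, Nat.cast_zero]
      linarith
    have hS : (S i).Nonempty := Finset.card_pos.1 (Nat.pos_of_ne_zero fun h0 => hne (by simp [h0]))
    have hT : (T i).Nonempty := Finset.card_pos.1 (Nat.pos_of_ne_zero fun h0 => hne (by simp [h0]))
    have hU : (U i).Nonempty := Finset.card_pos.1 (Nat.pos_of_ne_zero fun h0 => hne (by simp [h0]))
    have hsq := card_prod_sq_le_of_tpp (G i) (hTPP i) hS hT hU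
    have hsq' : N i ^ (2 : ℕ) ≤ (g i ^ (3 / 2 : ℝ)) ^ (2 : ℕ) := by
      have e2 : (g i ^ (3 / 2 : ℝ)) ^ (2 : ℕ) = ((Fintype.card (G i) ^ 3 : ℕ) : ℝ) := by
        rw [← Real.rpow_natCast, ← Real.rpow_mul (by positivity), Nat.cast_pow,
          show (3 / 2 : ℝ) * ((2 : ℕ) : ℝ) = ((3 : ℕ) : ℝ) by norm_num, Real.rpow_natCast]
      rw [e2, pow_two]
      change (((S i).card * (T i).card * (U i).card : ℕ) : ℝ) *
          (((S i).card * (T i).card * (U i).card : ℕ) : ℝ) ≤ ((Fintype.card (G i) ^ 3 : ℕ) : ℝ)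
      exact_mod_cast hsq
    exact le_of_pow_le_pow_left₀ two_ne_zero (by positivity) hsq'
  refine ⟨e, ?_, ?_⟩
  · -- `e → 0`: `0 ≤ e i ≤ ε` eventually
    refine Metric.tendsto_atTop.2 fun ε hε => ?_
    obtain ⟨i₀, hi₀⟩ := eventually_atTop.1 ((hPB (ε / 2) (by positivity)).and hN1)
    refine ⟨i₀, fun i hi => ?_⟩
    obtain ⟨hiP, hiN⟩ := hi₀ i hi
    rw [Real.dist_eq, sub_zero]
    by_cases hgi : 1 < g i
    · have hlogg : 0 < Real.log (g i) := Real.log_pos hgi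
      have hN0 : 0 < N i := by linarith
      -- lower bound `3/2 - ε/2 ≤ logb g N`
      have hlo : 3 / 2 - ε / 2 ≤ Real.logb (g i) (N i) := by
        rw [Real.le_logb_iff_rpow_le hgi hN0]
        exact hiP
      -- upper bound `logb g N ≤ 3/2`
      have hhi : Real.logb (g i) (N i) ≤ 3 / 2 := by
        rw [Real.logb_le_iff_le_rpow hgi hN0]
        exact hNle i hiN
      have he_def : e i = 3 / 2 - Real.logb (g i) (N i) := if_pos hgi
      rw [he_def, abs_of_nonneg (by linarith)]
      linarith
    · have he_def : e i = 0 := if_neg hgi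
      rw [he_def, abs_zero]
      exact hε
  · filter_upwards [hN1] with i hiN
    by_cases hgi : 1 < g i
    · have hN0 : 0 < N i := by linarith
      have he_def : e i = 3 / 2 - Real.logb (g i) (N i) := if_pos hgi
      change N i = g i ^ (3 / 2 - e i : ℝ)
      rw [he_def, sub_sub_cancel, Real.rpow_logb (by linarith [hg1 i]) hgi.ne' hN0]
    · -- `|G i| = 1`: then `1 ≤ N ≤ 1^{3/2}`
      have hg_eq : g i = 1 := le_antisymm (not_lt.1 hgi) (hg1 i)
      have he_def : e i = 0 := if_neg hgi
      change N i = g i ^ (3 / 2 - e i : ℝ)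
      have hle := hNle i hiN
      rw [hg_eq, Real.one_rpow] at hle
      rw [he_def, hg_eq, Real.one_rpow]
      linarith

end Exponent

end Literature.Barriers.MatrixMultiplication

end
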